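import Summits.Ventures.PackingBounds.Energy.FivePointRieszTwo
import Summits.Ventures.PackingBounds.Configurations.FivePointConfigs
import HarnessLib

/-!
# Five points on `S²`, Riesz 2-energy: the two-sided statement

Framing: lottery ticket; floor = certified bounds/negative ranges. Venture `PackingBounds`, cell
`pub-packcert`, energy family E3PT (pub-packcert-energy gen 10).

Combines the kernel-checked sharp three-point bound `FivePointRieszTwo.riesz_two_five_points`
(`Σ_{x ≠ y} 1/‖x-y‖² ≥ 17/2` for every five unit vectors of `ℝ³`) with the explicit triangular
bipyramid `Config.Bipyramid.pts` (inner products `-1, -1/2, 0`; `Config.Bipyramid.energy_pts`):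
the minimum of the Riesz 2-energy of five points on `S²` is exactly `17/2` (ordered pairs), attained
by the triangular bipyramid (R. E. Schwartz, Exp. Math. 22 (2013); here by an exact SDP certificate).
-/

noncomputable section

open Finset
open scoped RealInnerProductSpace

namespace Summit.Ventures.PackingBounds.Energy.FivePointRieszTwo

open Summit.Ventures.PackingBounds.Config

/-- The triangular bipyramid has Riesz 2-energy `17/2` (ordered pairs). -/
theorem bipyramid_riesz_two_energy :
    ∑ x ∈ Bipyramid.pts, ∑ y ∈ Bipyramid.pts.erase x, 1 / ‖x - y‖ ^ 2 = 17 / 2 := by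
  have h : ∀ x ∈ Bipyramid.pts, ∀ y ∈ Bipyramid.pts.erase x,
      1 / ‖x - y‖ ^ 2 = (fun t : ℝ => 1 / (2 - 2 * t)) (inner ℝ x y) := by
    intro x hx y hy
    have hyC : y ∈ Bipyramid.pts := Finset.mem_of_mem_erase hy
    have hn : ‖x - y‖ ^ 2 = 2 - 2 * inner ℝ x y := by
      rw [@norm_sub_sq_real, Bipyramid.norm_pts x hx, Bipyramid.norm_pts y hyC]; ring
    simp only [hn]
  have e := Bipyramid.energy_pts (fun t : ℝ => 1 / (2 - 2 * t))
  rw [Finset.sum_congr rfl fun x hx => Finset.sum_congr rfl fun y hy => h x hx y hy, e]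
  norm_num

/-- **Five points on `S²`, Riesz 2-energy, two-sided:** the least value of `Σ_{x ≠ y} 1/‖x-y‖²`
over five unit vectors of `ℝ³` is `17/2`, attained by the triangular bipyramid. -/
theorem riesz_two_five_points_isLeast :
    IsLeast {E : ℝ | ∃ C : Finset (EuclideanSpace ℝ (Fin 3)), C.card = 5 ∧ (∀ x ∈ C, ‖x‖ = 1) ∧
      E = ∑ x ∈ C, ∑ y ∈ C.erase x, 1 / ‖x - y‖ ^ 2} (17 / 2) := by
  refine ⟨⟨Bipyramid.pts, Bipyramid.card_pts, Bipyramid.norm_pts, bipyramid_riesz_two_energy.symm⟩, ?_⟩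
  rintro E ⟨C, h5, hC, rfl⟩
  exact riesz_two_five_points C hC h5

end Summit.Ventures.PackingBounds.Energy.FivePointRieszTwo
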